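import Summits.KontsevichZagierPeriods.KontsevichZagierPeriods.Theorems.LinRedNormalFormArrangementNormalFormStubRebaseSimpleZeroProductWedge

/-!
# Stub `stub_rebaseSimpleZero`, part `rebaseSimpleZero_product` (crux `ArrangementNormalForm`, line `janus-bands`, v6.2) — `Blow`

The BLOW-UP of one fibre `i` of a product representation over a one-dimensional base, pinched on
its letter line (rule 2 with `(y, sᵢ) ↦ (y, c(y) + sᵢ (y − p))`, spectators untouched, Jacobian
`y − p`): if both bounds of the fibre `i` pass through the point `(p, c(p))` of the letter line,
`Uᵢ = c + A (y − p)`, `Vᵢ = c + B (y − p)`, and the base cell lies on one side of `p`, the fibre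
becomes the CONSTANT interval `(A, B)` (or `(B, A)`) with the constant letter `1/sᵢ` and the
numerator picks up the sign `ε` (`RebaseZero.blow`); the pull-back form of rule (2) in dimension
`1 + k` (`RebaseZero.cov_pull`) and the rank-one determinant lemma. Registered:
`rebaseSimpleZeroProduct_det_one_add_smulRight`.

References: M. Kontsevich, D. Zagier, *Periods* (2001), §1.2, rule (2).
-/

noncomputable section

open Set MeasureTheory MvPolynomial
open Literature.NumberTheory.Transcendental Literature.ModelTheory.ExponentialFields

namespace Summit.KontsevichZagierPeriods.ArrangementNormalForm.JanusBands

namespace RebaseZero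

open SeparatePos RebasePos

variable {k : ℕ}

/-! ### Rule (2), pull-back form, in dimension `1 + k` -/

/-- **Rule (2), pull-back form.** If `Ψ` is `ℚ`-semialgebraic, injective and differentiable on a
`ℚ`-semialgebraic `R` with `Ψ '' R = r.domain`, and `f'` is a `ℚ`-semialgebraic function on `R`
with `f' = (r.integrand ∘ Ψ) · |det Ψ'|`, then `f'` is absolutely integrable on `R` and the
representation `r' = [R, f']` satisfies `[r] − [r'] ∈ KZ.relations`. [folklore] -/
theorem cov_pull {n : ℕ} (r : KZ.IntegralRep n) {R : Set (Fin n → ℝ)} (hR : IsSemialgebraic ℚ R)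
    (Ψ : (Fin n → ℝ) → (Fin n → ℝ)) (Ψ' : (Fin n → ℝ) → (Fin n → ℝ) →L[ℝ] (Fin n → ℝ))
    (hsa : IsSemialgebraicMapOn ℚ R Ψ) (hder : ∀ x ∈ R, HasFDerivWithinAt Ψ (Ψ' x) R x)
    (hinj : InjOn Ψ R) (himg : Ψ '' R = r.domain) (f' : (Fin n → ℝ) → ℝ)
    (hf'sa : IsSemialgebraicFunOn ℚ R f')
    (hf : ∀ x ∈ R, f' x = r.integrand (Ψ x) * |(Ψ' x).det|) :
    ∃ r' : KZ.IntegralRep n, r'.domain = R ∧ r'.integrand = f' ∧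
      KZ.of r - KZ.of r' ∈ KZ.relations := by
  have hRm : MeasurableSet R := IsSemialgebraic.measurableSet_holds hR
  have hint : IntegrableOn f' R := by
    have h1 := r.integrableOn
    rw [← himg, integrableOn_image_iff_integrableOn_abs_det_fderiv_smul volume hRm hder hinj] at h1
    refine h1.congr_fun (fun x hx => ?_) hRm
    simp only [hf x hx, smul_eq_mul, mul_comm]
  refine ⟨⟨R, f', hR, hf'sa, hint⟩, rfl, rfl, ?_⟩
  have hcov : KZ.of (⟨R, f', hR, hf'sa, hint⟩ : KZ.IntegralRep n) - KZ.of r ∈ KZ.relations :=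
    KZ.changeOfVariablesRel_subset_relations
      ⟨n, _, r, Ψ, Ψ', hsa, hder, hinj, himg.symm, fun x hx => hf x hx, rfl⟩
  have := KZ.relations.neg_mem hcov
  rwa [neg_sub] at this

/-- **Rank-one determinant lemma** `det (1 + x ⊗ f) = 1 + f x`. [folklore] -/
theorem det_one_add_smulRight {n : ℕ} (f : (Fin n → ℝ) →ₗ[ℝ] ℝ) (x : Fin n → ℝ) :
    LinearMap.det (1 + f.smulRight x) = 1 + f x := by
  -- adapted from `LinearMap.det_one_add_smulRight` (Literature.Analysis.FluidPDE.CollisionCylinder)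
  classical
  let b := Module.finBasis ℝ (Fin n → ℝ)
  rw [← LinearMap.det_toMatrix b, map_add, LinearMap.toMatrix_one, LinearMap.toMatrix_smulRight,
    Matrix.vecMulVec_eq (Fin 1), Matrix.det_one_add_replicateCol_mul_replicateRow]
  congr 1
  calc (f ∘ b) ⬝ᵥ (b.repr x) = ∑ i, (b.repr x) i * f (b i) := by
        simp [dotProduct, mul_comm]
    _ = f (∑ i, (b.repr x) i • b i) := by rw [_root_.map_sum]; simp
    _ = f x := by rw [b.sum_repr]

/-- The continuous version of the rank-one determinant lemma. [folklore] -/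
theorem det_id_add_smulRight {n : ℕ} (f : (Fin n → ℝ) →L[ℝ] ℝ) (x : Fin n → ℝ) :
    (ContinuousLinearMap.id ℝ _ + f.smulRight x).det = 1 + f x := by
  have key : ((ContinuousLinearMap.id ℝ _ + f.smulRight x : (Fin n → ℝ) →L[ℝ] (Fin n → ℝ)) :
      (Fin n → ℝ) →ₗ[ℝ] (Fin n → ℝ)) = 1 + (f : (Fin n → ℝ) →ₗ[ℝ] ℝ).smulRight x := by
    ext v
    simp
  rw [ContinuousLinearMap.det, key, det_one_add_smulRight]
  rfl

/-! ### The blow-up map -/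

/-- `fibBlow` on the moved coordinate. [folklore] -/
theorem fibBlow_self (i : Fin k) (γ δ p : ℝ) (z : Fin (0 + 1 + k) → ℝ) :
    tv (fibBlow i γ δ p z) i = γ * yv z + δ + tv z i * (yv z - p) := by
  simp only [tv, fibBlow, Pi.add_apply, Pi.smul_apply, Pi.single_eq_same, smul_eq_mul, mul_one]
  simp only [yv]; ring

/-- `fibBlow` fixes the other coordinates. [folklore] -/
theorem fibBlow_of_ne (i : Fin k) (γ δ p : ℝ) (z : Fin (0 + 1 + k) → ℝ) {j : Fin (0 + 1 + k)}
    (hj : j ≠ tIdx i) : fibBlow i γ δ p z j = z j := by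
  simp only [fibBlow, Pi.add_apply, Pi.smul_apply, Pi.single_eq_of_ne hj, smul_zero, add_zero]

/-- `fibBlow` fixes the base coordinate. [folklore] -/
@[simp] theorem yv_fibBlow (i : Fin k) (γ δ p : ℝ) (z : Fin (0 + 1 + k) → ℝ) :
    yv (fibBlow i γ δ p z) = yv z :=
  fibBlow_of_ne i γ δ p z (yIdx_ne_tIdx i)

/-- `fibBlow` fixes the spectator fibres. [folklore] -/
theorem tv_fibBlow_of_ne (i : Fin k) (γ δ p : ℝ) (z : Fin (0 + 1 + k) → ℝ) {j : Fin k} (hj : j ≠ i) :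
    tv (fibBlow i γ δ p z) j = tv z j :=
  fibBlow_of_ne i γ δ p z (tIdx_injective.ne hj)

/-- The derivative of `fibBlow`. [folklore] -/
theorem hasFDerivAt_fibBlow (i : Fin k) (γ δ p : ℝ) (z : Fin (0 + 1 + k) → ℝ) :
    HasFDerivAt (fibBlow i γ δ p) (fibBlowL i γ p z) z := by
  have h1 : HasFDerivAt (fun z : Fin (0 + 1 + k) → ℝ => z (yIdx k))
      (ContinuousLinearMap.proj (R := ℝ) (φ := fun _ : Fin (0 + 1 + k) => ℝ) (yIdx k)) z :=
    hasFDerivAt_apply (yIdx k) z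
  have h2 : HasFDerivAt (fun z : Fin (0 + 1 + k) → ℝ => z (tIdx i))
      (ContinuousLinearMap.proj (R := ℝ) (φ := fun _ : Fin (0 + 1 + k) => ℝ) (tIdx i)) z :=
    hasFDerivAt_apply (tIdx i) z
  have hφ : HasFDerivAt (fun z : Fin (0 + 1 + k) → ℝ => γ * yv z + δ + tv z i * (yv z - p) - tv z i)
      (γ • (ContinuousLinearMap.proj (R := ℝ) (φ := fun _ : Fin (0 + 1 + k) => ℝ) (yIdx k)) +
        (z (tIdx i) • (ContinuousLinearMap.proj (R := ℝ) (φ := fun _ : Fin (0 + 1 + k) => ℝ) (yIdx k)) +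
          (z (yIdx k) - p) • (ContinuousLinearMap.proj (R := ℝ) (φ := fun _ : Fin (0 + 1 + k) => ℝ) (tIdx i))) -
        (ContinuousLinearMap.proj (R := ℝ) (φ := fun _ : Fin (0 + 1 + k) => ℝ) (tIdx i))) z :=
    (((h1.const_mul γ).add_const δ).add (h2.mul (h1.sub_const p))).sub h2
  exact (hasFDerivAt_id z).add (hφ.smul_const (Pi.single (tIdx i) (1 : ℝ) : Fin (0 + 1 + k) → ℝ))

/-- The Jacobian determinant of `fibBlow` is `y − p`. [folklore] -/
theorem det_fibBlowL (i : Fin k) (γ p : ℝ) (z : Fin (0 + 1 + k) → ℝ) :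
    (fibBlowL i γ p z).det = yv z - p := by
  rw [fibBlowL, det_id_add_smulRight]
  simp [Pi.single_eq_of_ne (yIdx_ne_tIdx i), yv]

/-- `fibBlow` is injective off the wall `y = p`. [folklore] -/
theorem fibBlow_injOn (i : Fin k) (γ δ p : ℝ) {R : Set (Fin (0 + 1 + k) → ℝ)}
    (hR : ∀ z ∈ R, yv z ≠ p) : InjOn (fibBlow i γ δ p) R := by
  intro z hz w _ h
  have hne : ∀ j, j ≠ tIdx i → z j = w j := fun j hj => by
    rw [← fibBlow_of_ne i γ δ p z hj, h, fibBlow_of_ne i γ δ p w hj]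
  have hy : yv z = yv w := hne _ (yIdx_ne_tIdx i)
  have ht : tv z i = tv w i := by
    have h' := congrArg (fun x => tv x i) h
    simp only [fibBlow_self, hy] at h'
    exact mul_right_cancel₀ (sub_ne_zero.2 (hy ▸ hR z hz)) (by linarith)
  funext j
  by_cases hj : j = tIdx i
  · rw [hj]; exact ht
  · exact hne j hj

/-- `fibBlow` with rational data is a semialgebraic map. [folklore] -/
theorem isSemialgebraicMapOn_fibBlow (i : Fin k) (γ δ p : ℚ) {R : Set (Fin (0 + 1 + k) → ℝ)}
    (hR : IsSemialgebraic ℚ R) : IsSemialgebraicMapOn ℚ R (fibBlow i γ δ p) := by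
  refine (isSemialgebraicMapOn_aeval hR (Function.update (fun l => X l) (tIdx i)
    (MvPolynomial.C γ * X (yIdx k) + MvPolynomial.C δ + X (tIdx i) * (X (yIdx k) - MvPolynomial.C p)))).congr
    fun z _ => ?_
  funext l
  dsimp only
  by_cases hl : l = tIdx i
  · subst hl
    rw [Function.update_self]
    have := fibBlow_self i γ δ p z
    simp only [tv, yv] at this
    rw [this]
    simp
  · rw [Function.update_of_ne hl, fibBlow_of_ne i γ δ p z hl]
    simp

/-! ### The blow-up move -/

/-- Scaling the numerator scales the literal integrand. [folklore] -/
theorem glit_C_mul (T : BData) (q : ℚ) (p : MvPolynomial (Fin 0) ℚ) (a : Fin k → Option Cf)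
    (z : Fin (0 + 1 + k) → ℝ) : glitB T (MvPolynomial.C q * p) a z = q * glitB T p a z := by
  simp only [glitB, glit_eq, map_mul, MvPolynomial.aeval_C, eq_ratCast]
  ring

/-- **Blow-up of a fibre pinched on its letter line** (rule 2 with
`(y, sᵢ) ↦ (y, c(y) + sᵢ (y − p))`, Jacobian `y − p`): if both bounds of the lettered fibre `i`
pass through the point `(p, c(p))` of the letter line, `Uᵢ = c + A (y − p)`,
`Vᵢ = c + B (y − p)`, and the base cell lies on one side of `p` (`ε (y − p) > 0`), then the
fibre `i` becomes the constant interval `(A, B)` (resp. `(B, A)`) with the constant letter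
`1/sᵢ`, the numerator picks up `ε`, the spectators are untouched, and the two representations
differ by a relation. -/
theorem blow {s : KZ.IntegralRep (0 + 1 + k)} {m' : ℕ} {M : Fin m' → Cf} {U V : Fin k → Cf}
    {T : BData} {p : MvPolynomial (Fin 0) ℚ} {a : Fin k → Option Cf} (h : IsProd s M U V T p a)
    (i : Fin k) (c : Cf) (ha : a i = some c) (p₀ A B ε : ℚ) (hε : ε = 1 ∨ ε = -1)
    (hI : ∀ y ∈ cell M, 0 < (ε : ℝ) * (y - p₀) ∧ ev (U i) y < ev (V i) y)
    (hU : ∀ y : ℝ, ev (U i) y = ev c y + A * (y - p₀))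
    (hV : ∀ y : ℝ, ev (V i) y = ev c y + B * (y - p₀)) :
    ∃ s' : KZ.IntegralRep (0 + 1 + k),
      IsProd s' M (Function.update U i (mk 0 (if ε = 1 then A else B)))
        (Function.update V i (mk 0 (if ε = 1 then B else A))) T (MvPolynomial.C ε * p)
        (Function.update a i (some 0)) ∧
      KZ.of s - KZ.of s' ∈ KZ.relations := by
  set lo : ℚ := if ε = 1 then A else B with hlo
  set hi : ℚ := if ε = 1 then B else A with hhi
  set U' := Function.update U i (mk 0 lo) with hU'
  set V' := Function.update V i (mk 0 hi) with hV'
  set a' : Fin k → Option Cf := Function.update a i (some 0) with ha'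
  set R := pDom M U' V' with hRdef
  set f' := glitB T (MvPolynomial.C ε * p) a' with hf'
  set F := glitB T p (Function.update a i none) with hF
  set Ψ := fibBlow i (c.1 (Fin.last 0) : ℝ) (c.2 : ℝ) (p₀ : ℝ) with hΨ
  have hΨi : ∀ z, tv (Ψ z) i = ev c (yv z) + tv z i * (yv z - p₀) := fun z => by
    rw [hΨ, fibBlow_self]; rfl
  have hne : ∀ y ∈ cell M, (y : ℝ) - p₀ ≠ 0 := fun y hy h0 => by
    have := (hI y hy).1; rw [h0, mul_zero] at this; exact lt_irrefl _ this
  -- fibres: `Uᵢ(y) < c(y) + s (y - p) < Vᵢ(y) ↔ lo < s < hi`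
  have hfib : ∀ y ∈ cell M, ∀ t : ℝ, (ev (U i) y < ev c y + t * (y - p₀) ∧
      ev c y + t * (y - p₀) < ev (V i) y) ↔ ((lo : ℝ) < t ∧ t < hi) := by
    intro y hy t
    rw [hU, hV]
    rcases hε with rfl | rfl
    · have hp : 0 < (y : ℝ) - p₀ := by simpa using (hI y hy).1
      simp only [hlo, hhi, if_true]
      constructor
      · rintro ⟨h1, h2⟩
        exact ⟨lt_of_mul_lt_mul_right (by linarith) hp.le, lt_of_mul_lt_mul_right (by linarith) hp.le⟩
      · rintro ⟨h1, h2⟩; constructor <;> nlinarith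
    · have hp : (y : ℝ) - p₀ < 0 := by have := (hI y hy).1; push_cast at this; linarith
      simp only [hlo, hhi, show ¬((-1 : ℚ) = 1) by norm_num, if_false]
      constructor
      · rintro ⟨h1, h2⟩; constructor <;> nlinarith
      · rintro ⟨h1, h2⟩; constructor <;> nlinarith
  have keyR : ∀ z, z ∈ R ↔ yv z ∈ cell M ∧ ((lo : ℝ) < tv z i ∧ tv z i < hi) ∧
      ∀ j, j ≠ i → ev (U j) (yv z) < tv z j ∧ tv z j < ev (V j) (yv z) := fun z => by
    rw [hRdef, mem_pDom]
    refine and_congr_right fun _ => ⟨fun h' => ⟨by simpa [hU', hV'] using h' i, fun j hj => by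
      simpa [hU', hV', Function.update_of_ne hj] using h' j⟩, fun h' j => ?_⟩
    by_cases hj : j = i
    · subst hj; simpa [hU', hV'] using h'.1
    · simpa [hU', hV', Function.update_of_ne hj] using h'.2 j hj
  have keyD : ∀ z, z ∈ s.domain ↔ yv z ∈ cell M ∧ (ev (U i) (yv z) < tv z i ∧ tv z i < ev (V i) (yv z)) ∧
      ∀ j, j ≠ i → ev (U j) (yv z) < tv z j ∧ tv z j < ev (V j) (yv z) := fun z => by
    rw [h.dom, mem_pDom]
    refine and_congr_right fun _ => ⟨fun h' => ⟨h' i, fun j _ => h' j⟩, fun h' j => ?_⟩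
    by_cases hj : j = i
    · subst hj; exact h'.1
    · exact h'.2 j hj
  have hmem : ∀ z, z ∈ R ↔ Ψ z ∈ s.domain := fun z => by
    rw [keyR, keyD, hΨ, yv_fibBlow, ← hΨ, hΨi]
    refine and_congr_right fun hy => and_congr (hfib _ hy _).symm ?_
    refine forall_congr' fun j => forall_congr' fun hj => ?_
    rw [hΨ, tv_fibBlow_of_ne _ _ _ _ _ hj]
  -- the inverse map
  set Φ : (Fin (0 + 1 + k) → ℝ) → (Fin (0 + 1 + k) → ℝ) := fun z =>
    Function.update z (tIdx i) ((tv z i - ev c (yv z)) / (yv z - p₀)) with hΦ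
  have hΨΦ : ∀ z ∈ s.domain, Ψ (Φ z) = z := fun z hz => by
    have hz0 : yv z ∈ cell M := ((keyD z).1 hz).1
    funext l
    by_cases hl : l = tIdx i
    · rw [hl]
      show tv (Ψ (Φ z)) i = tv z i
      rw [hΨi, hΦ, yv_update, tv_update_self]
      field_simp [hne _ hz0]
      ring
    · rw [hΨ, fibBlow_of_ne _ _ _ _ _ hl, hΦ]
      exact Function.update_of_ne hl _ _
  have himg : Ψ '' R = s.domain := by
    ext z
    constructor
    · rintro ⟨z', hz', rfl⟩; exact (hmem z').1 hz'
    · intro hz; exact ⟨Φ z, (hmem _).2 (by rw [hΨΦ z hz]; exact hz), hΨΦ z hz⟩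
  have habs : ∀ y ∈ cell M, |(y : ℝ) - p₀| = ε * (y - p₀) := by
    intro y hy
    rcases hε with rfl | rfl
    · have hp : 0 < (y : ℝ) - p₀ := by simpa using (hI y hy).1
      rw [abs_of_pos hp]; simp
    · have hp : (y : ℝ) - p₀ < 0 := by have := (hI y hy).1; push_cast at this; linarith
      rw [abs_of_neg hp]; simp
  have hFΨ : ∀ z, F (Ψ z) = F z := fun z =>
    glit_congr T p _ (fun j' => fibBlow_of_ne i _ _ _ z (IntegrateOutLow.castAdd_ne_natAdd j' i))
      fun j hj => fibBlow_of_ne i _ _ _ z (tIdx_injective.ne fun hji => hj (by subst hji; simp))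
  have hint : ∀ z ∈ R, f' z = s.integrand (Ψ z) * |(fibBlowL i (c.1 (Fin.last 0) : ℝ) (p₀ : ℝ) z).det| := by
    intro z hz
    have hz0 : yv z ∈ cell M := ((keyR z).1 hz).1
    rw [det_fibBlowL, h.int ((hmem z).1 hz), habs _ hz0, hf', glit_C_mul,
      glit_split T p a' i 0 (by simp [ha']) z, glit_split T p a i c ha (Ψ z)]
    rw [show Function.update a' i none = Function.update a i none by rw [ha', Function.update_idem]]
    rw [← hF, hFΨ, hΨi, hΨ, yv_fibBlow]
    simp only [ev, Rat.cast_zero, zero_mul, add_zero, sub_zero, add_sub_cancel_left,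
      Prod.fst_zero, Prod.snd_zero, Pi.zero_apply]
    rcases eq_or_ne (tv z i) 0 with h0 | h0
    · simp [h0]
    · field_simp [hne _ hz0]
  obtain ⟨s', hs'd, hs'i, hrel⟩ := cov_pull s (isSemialgebraic_pDom M U' V') Ψ
    (fibBlowL i (c.1 (Fin.last 0) : ℝ) (p₀ : ℝ)) (isSemialgebraicMapOn_fibBlow i _ _ _ (isSemialgebraic_pDom _ _ _))
    (fun z _ => (hasFDerivAt_fibBlow _ _ _ _ z).hasFDerivWithinAt)
    (fibBlow_injOn _ _ _ _ fun z hz => sub_ne_zero.1 (hne _ ((keyR z).1 hz).1)) himg f'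
    (isSemialgebraicFunOn_glit (isSemialgebraic_pDom _ _ _) _ _ _ _ _ _ _ _) hint
  obtain ⟨Rb, hRb⟩ := h.cbd
  exact ⟨s', ⟨hs'd, fun z _ => by rw [hs'i], h.adm, Rb, hRb⟩, hrel⟩

end RebaseZero

/-- Registered support goal of this file: the rank-one determinant lemma. -/
theorem rebaseSimpleZeroProduct_det_one_add_smulRight (n : ℕ) (f : (Fin n → ℝ) →ₗ[ℝ] ℝ) (x : Fin n → ℝ) : LinearMap.det (1 + f.smulRight x) = 1 + f x :=
  RebaseZero.det_one_add_smulRight f x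

end Summit.KontsevichZagierPeriods.ArrangementNormalForm.JanusBands
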